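import Mathlib
import Summits.CriticalPhenomena.Ising3DConformalLimit.Theses.GaussianScaleMixture
import Summits.CriticalPhenomena.Ising3DConformalLimit.Theorems.GaussianScaleMixtureCriticalTwoPointGSMExistsExchangeableRepOfRep
import Summits.CriticalPhenomena.Ising3DConformalLimit.Theorems.GaussianScaleMixtureCriticalTwoPointGSMSubcriticalTransfer
import Summits.CriticalPhenomena.Ising3DConformalLimit.Theorems.GaussianScaleMixtureCriticalTwoPointGSMCubeRepOfApproximants
import Summits.CriticalPhenomena.Ising3DConformalLimit.Theorems.GaussianScaleMixtureCriticalTwoPointGSMCriticalTwoPointGSMOfCubeRepNoFace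
import Summits.CriticalPhenomena.Ising3DConformalLimit.Theorems.GaussianScaleMixtureCriticalTwoPointGSMCubeRepApproxOfDualCone
import Summits.CriticalPhenomena.Ising3DConformalLimit.Theorems.GaussianScaleMixtureCriticalTwoPointGSMCubeRepOfCubeRepApprox
import Summits.CriticalPhenomena.Ising3DConformalLimit.Theorems.GaussianScaleMixtureCriticalTwoPointGSMCubeRepIffDualCone

/-!
# Line `Sketch` (lead's skeleton, seat c2 reshape) — crux `CriticalTwoPointGSM` (stmt-CriticalPhenomena-8365)

Route `GaussianScaleMixture` of `Ising3DConformalLimit`; crux r2: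
`⟨σ₀σ_x⟩⁺_{β_c}` on `ℤ³` is a Gaussian scale mixture (GSM) in the squared coordinates.

## The reshape (seat c2): the necessary-and-sufficient split

Cube coordinates `tᵢ = e^{-sᵢ} ∈ (0,1]`, kernel `∏ tᵢ^{xᵢ²}` (`ℕ`-powers, `0⁰ = 1`). A probability
measure `μ` on `ℝ³` carried by the CLOSED cube `[0,1]³` with `G x = ∫ ∏ tᵢ^{xᵢ²} dμ` is a CUBE
REPRESENTATION of `G` = membership of `G` in the closed GSM cone on `ℤ³`; the faces `tᵢ = 0` are
clocks of infinite speed. Seats -0, -1 and c1 landed (all ACCEPTED, `--supports` this item):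

* crux ⇔ cube representation of `criticalTwoPoint 3` WITHOUT face mass (p98640,
  `Theorems.criticalTwoPointGSM_iff_cubeRepNoFace`);
* pointwise limits of probability-GSM kernels always have a cube representation (p96539);
* cube representation ⇔ `G 0 = 1` ∧ every dual-cone (square-lacunary certificate) inequality
  (p102809 finite-family separation + p104062 Prokhorov on the cube; assembled below as the stub
  `cubeRep_iff_dualCone`);
* the route's only consumer of the crux, `LimitKernelGSM`, already follows from a cube
  representation WITH faces (p100954, `Theorems.limitKernelGSM_of_cubeRep`).

Hence the crux splits into two conjuncts that are BOTH NECESSARY (proved below: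
`closedConeGSM_of_criticalTwoPointGSM`, `faceAbsorption_of_criticalTwoPointGSM`) and jointly
sufficient (`CriticalTwoPointGSM_of`):

    crux  ⇔  closedConeGSM  ∧  faceAbsorption                    (`criticalTwoPointGSM_iff_closedCone_faceAbsorption`)

* `closedConeGSM` (STUB, the physical input, OPEN): `criticalTwoPoint 3` has a cube representation
  — equivalently (`dualCone_of_closedConeGSM`) it passes every square-lacunary dual-cone
  certificate `∑ cₖ G(xₖ) ≥ 0` whenever `∑ cₖ ∏ tᵢ^{x_{k,i}²} ≥ 0` on `[0,1]³`. This is exactly the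
  falsifiable content of the crux (what the disprover's numerics F5–F9 test) and exactly what the
  route consumes (p100954). Unlike the physical stubs of the earlier shapes it is NOT stronger than
  the crux: `subcriticalTightGSM` (seat -0) ⊋ `subcriticalGSM` (seat -1) ⇒ `closedConeGSM`
  (`closedConeGSM_of_subcriticalGSM`, left-continuity at `β_c` + p96539), `rpInterpolatedGSM`
  (seat c1) ⇒ crux ⇒ `closedConeGSM`.
* `faceAbsorption` (STUB, the residue, registered by seat -1 verbatim): a cube representation of
  `criticalTwoPoint 3` can be chosen without face mass. Necessary for the crux as typed, invisible
  to every lattice datum and to the axis spectral measures (Müntz: `∑ 1/n² < ∞`), void if the crux is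
  re-typed as `closedConeGSM` (recommended to the planners by seat -1; the route loses nothing).
* `cubeRep_iff_dualCone` (glue, LANDED p123076 by this seat's worker; registered by seat -1):
  closed cone = dual cone.

## Composition

`CriticalTwoPointGSM_of := Theorems.criticalTwoPointGSM_of_cubeRepNoFace (faceAbsorption closedConeGSM)`.
-/

namespace Summit.CriticalPhenomena.Ising3DConformalLimit.Cruxes.CriticalTwoPointGSM.Lines.Sketch

open MeasureTheory Filter Topology
open Literature.Probability.LatticeModels
open Summit.CriticalPhenomena.Ising3DConformalLimit.Theses.GaussianScaleMixture (CriticalTwoPointGSM)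
open scoped BigOperators

noncomputable section

/-! ## Stubs -/

/-- **STUB `closedConeGSM` (physical input; OPEN).** The critical two-point function of the
nearest-neighbour Ising model on `ℤ³` lies in the CLOSED Gaussian-scale-mixture cone: there is a
probability measure `μ` on `ℝ³` carried by the closed cube `[0,1]³` with
`⟨σ₀σ_x⟩⁺_{β_c} = ∫ ∏ᵢ tᵢ^{xᵢ²} dμ(t)` for every `x ∈ ℤ³` (faces `tᵢ = 0` allowed, `0⁰ = 1`).
Equivalent to: every square-lacunary dual-cone certificate passes (`dualCone_of_closedConeGSM`,
`closedConeGSM_of_dualCone`). Necessary for the crux (`closedConeGSM_of_criticalTwoPointGSM`). -/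
theorem closedConeGSM :
    ∃ μ : Measure (Fin 3 → ℝ), IsProbabilityMeasure μ ∧ μ {t | ∃ i, t i < 0 ∨ 1 < t i} = 0 ∧
      ∀ x : Site 3, criticalTwoPoint 3 x = ∫ t, ∏ i, (t i) ^ ((x i).natAbs ^ 2) ∂μ := by
  sorry

/-- **STUB `faceAbsorption` (the residue; NECESSARY for the crux, `faceAbsorption_of_criticalTwoPointGSM`).**
If `criticalTwoPoint 3` has a cube representation (closed-cone membership), then it has one
WITHOUT face mass (`μ {∃ i, tᵢ ≤ 0 ∨ 1 < tᵢ} = 0`, i.e. carried by `(0,1]³`). -/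
theorem faceAbsorption
    (h : ∃ μ : Measure (Fin 3 → ℝ), IsProbabilityMeasure μ ∧ μ {t | ∃ i, t i < 0 ∨ 1 < t i} = 0 ∧
      ∀ x : Site 3, criticalTwoPoint 3 x = ∫ t, ∏ i, (t i) ^ ((x i).natAbs ^ 2) ∂μ) :
    ∃ μ : Measure (Fin 3 → ℝ), IsProbabilityMeasure μ ∧ μ {t | ∃ i, t i ≤ 0 ∨ 1 < t i} = 0 ∧
      ∀ x : Site 3, criticalTwoPoint 3 x = ∫ t, ∏ i, (t i) ^ ((x i).natAbs ^ 2) ∂μ := by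
  sorry

/-- **Glue, LANDED p123076** (`Theorems.cubeRep_iff_dualCone`,
`Theorems/GaussianScaleMixtureCriticalTwoPointGSMCubeRepIffDualCone.lean`; registered stub of seat -1,
landed by this seat's worker; pure convex analysis). A kernel `G` on `ℤ³` has a cube representation
iff `G 0 = 1` and it passes EVERY dual-cone inequality: `∑ cₖ G(xₖ) ≥ 0` whenever
`∑ cₖ ∏ tᵢ^{x_{k,i}²} ≥ 0` on `[0,1]³` (`→`: integrate the pointwise inequality; `←`:
`Theorems.cubeRepApprox_of_dualCone` p102809 + `Theorems.cubeRep_of_cubeRepApprox` p104062). -/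
theorem cubeRep_iff_dualCone (G : Site 3 → ℝ) :
    (∃ μ : Measure (Fin 3 → ℝ), IsProbabilityMeasure μ ∧ μ {t | ∃ i, t i < 0 ∨ 1 < t i} = 0 ∧
      ∀ x : Site 3, G x = ∫ t, ∏ i, (t i) ^ ((x i).natAbs ^ 2) ∂μ) ↔
    (G 0 = 1 ∧ ∀ (m : ℕ) (c : Fin m → ℝ) (x : Fin m → Site 3),
      (∀ t : Fin 3 → ℝ, (∀ i, 0 ≤ t i ∧ t i ≤ 1) → 0 ≤ ∑ k, c k * ∏ i, (t i) ^ ((x k i).natAbs ^ 2)) →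
      0 ≤ ∑ k, c k * G (x k)) :=
  Theorems.cubeRep_iff_dualCone G

/-! ## Glue proved in the skeleton -/

/-- **Necessity of the physical stub.** The crux gives closed-cone membership: a representation
without face mass (`Theorems.cubeRepNoFace_of_criticalTwoPointGSM`, p98640) is in particular a
cube representation (`{tᵢ < 0 ∨ 1 < tᵢ} ⊆ {tᵢ ≤ 0 ∨ 1 < tᵢ}`). -/
theorem closedConeGSM_of_criticalTwoPointGSM (h : CriticalTwoPointGSM) :
    ∃ μ : Measure (Fin 3 → ℝ), IsProbabilityMeasure μ ∧ μ {t | ∃ i, t i < 0 ∨ 1 < t i} = 0 ∧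
      ∀ x : Site 3, criticalTwoPoint 3 x = ∫ t, ∏ i, (t i) ^ ((x i).natAbs ^ 2) ∂μ := by
  obtain ⟨μ, hP, hface, hrep⟩ := Theorems.cubeRepNoFace_of_criticalTwoPointGSM h
  refine ⟨μ, hP, ?_, hrep⟩
  refine measure_mono_null (fun t ht => ?_) hface
  obtain ⟨i, hi⟩ := ht
  exact ⟨i, hi.imp le_of_lt id⟩

/-- **Necessity of the residue.** The crux gives the conclusion of `faceAbsorption` outright
(`Theorems.cubeRepNoFace_of_criticalTwoPointGSM`, p98640), whatever the hypothesis. -/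
theorem faceAbsorption_of_criticalTwoPointGSM (h : CriticalTwoPointGSM)
    (_hcube : ∃ μ : Measure (Fin 3 → ℝ), IsProbabilityMeasure μ ∧ μ {t | ∃ i, t i < 0 ∨ 1 < t i} = 0 ∧
      ∀ x : Site 3, criticalTwoPoint 3 x = ∫ t, ∏ i, (t i) ^ ((x i).natAbs ^ 2) ∂μ) :
    ∃ μ : Measure (Fin 3 → ℝ), IsProbabilityMeasure μ ∧ μ {t | ∃ i, t i ≤ 0 ∨ 1 < t i} = 0 ∧
      ∀ x : Site 3, criticalTwoPoint 3 x = ∫ t, ∏ i, (t i) ^ ((x i).natAbs ^ 2) ∂μ :=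
  Theorems.cubeRepNoFace_of_criticalTwoPointGSM h

/-- **The split is exact.** crux ⇔ (closed-cone membership) ∧ (face absorption). -/
theorem criticalTwoPointGSM_iff_closedCone_faceAbsorption :
    CriticalTwoPointGSM ↔
      ((∃ μ : Measure (Fin 3 → ℝ), IsProbabilityMeasure μ ∧ μ {t | ∃ i, t i < 0 ∨ 1 < t i} = 0 ∧
          ∀ x : Site 3, criticalTwoPoint 3 x = ∫ t, ∏ i, (t i) ^ ((x i).natAbs ^ 2) ∂μ) ∧
        ((∃ μ : Measure (Fin 3 → ℝ), IsProbabilityMeasure μ ∧ μ {t | ∃ i, t i < 0 ∨ 1 < t i} = 0 ∧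
            ∀ x : Site 3, criticalTwoPoint 3 x = ∫ t, ∏ i, (t i) ^ ((x i).natAbs ^ 2) ∂μ) →
          ∃ μ : Measure (Fin 3 → ℝ), IsProbabilityMeasure μ ∧ μ {t | ∃ i, t i ≤ 0 ∨ 1 < t i} = 0 ∧
            ∀ x : Site 3, criticalTwoPoint 3 x = ∫ t, ∏ i, (t i) ^ ((x i).natAbs ^ 2) ∂μ)) :=
  ⟨fun h => ⟨closedConeGSM_of_criticalTwoPointGSM h, faceAbsorption_of_criticalTwoPointGSM h⟩,
    fun h => Theorems.criticalTwoPointGSM_of_cubeRepNoFace (h.2 h.1)⟩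

/-- **The physical stub in certificate form.** Closed-cone membership of `criticalTwoPoint 3` ⇒
every square-lacunary dual-cone certificate passes (the disprover's kill switch
`Disproof.dual_cone`, now for the closed cone). -/
theorem dualCone_of_closedConeGSM
    (h : ∃ μ : Measure (Fin 3 → ℝ), IsProbabilityMeasure μ ∧ μ {t | ∃ i, t i < 0 ∨ 1 < t i} = 0 ∧
      ∀ x : Site 3, criticalTwoPoint 3 x = ∫ t, ∏ i, (t i) ^ ((x i).natAbs ^ 2) ∂μ)
    {m : ℕ} (c : Fin m → ℝ) (x : Fin m → Site 3)
    (hc : ∀ t : Fin 3 → ℝ, (∀ i, 0 ≤ t i ∧ t i ≤ 1) → 0 ≤ ∑ k, c k * ∏ i, (t i) ^ ((x k i).natAbs ^ 2)) :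
    0 ≤ ∑ k, c k * criticalTwoPoint 3 (x k) :=
  ((cubeRep_iff_dualCone (criticalTwoPoint 3)).1 h).2 m c x hc

/-- **… and conversely**: if every certificate passes, `criticalTwoPoint 3` is in the closed cone
(`criticalTwoPoint_zero'`: `G 0 = 1`). So `closedConeGSM` is EXACTLY "no square-lacunary
certificate is violated". -/
theorem closedConeGSM_of_dualCone
    (hdual : ∀ (m : ℕ) (c : Fin m → ℝ) (x : Fin m → Site 3),
      (∀ t : Fin 3 → ℝ, (∀ i, 0 ≤ t i ∧ t i ≤ 1) → 0 ≤ ∑ k, c k * ∏ i, (t i) ^ ((x k i).natAbs ^ 2)) →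
      0 ≤ ∑ k, c k * criticalTwoPoint 3 (x k)) :
    ∃ μ : Measure (Fin 3 → ℝ), IsProbabilityMeasure μ ∧ μ {t | ∃ i, t i < 0 ∨ 1 < t i} = 0 ∧
      ∀ x : Site 3, criticalTwoPoint 3 x = ∫ t, ∏ i, (t i) ^ ((x i).natAbs ^ 2) ∂μ :=
  (cubeRep_iff_dualCone (criticalTwoPoint 3)).2 ⟨criticalTwoPoint_zero' (d := 3), hdual⟩

/-- **Entry from the subcritical spine (seats -0 and -1).** GSM of `⟨σ₀σ_x⟩^∅_{βₙ}` along SOME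
`βₙ ↑ β_c` (probability mixing measures on the closed octant, NO tightness) ⇒ `closedConeGSM`, by
left-continuity of `β ↦ ⟨σ₀σ_x⟩^∅_β` at `β_c`
(`Theorems.CriticalTwoPointGSMTransfer.twoPointFree_seq_tendsto_criticalTwoPoint`, p89797) and
`Theorems.cubeRep_of_approximants` (p96539). -/
theorem closedConeGSM_of_subcriticalGSM
    (h : ∃ (β : ℕ → ℝ) (ν : ℕ → Measure (Fin 3 → ℝ)),
      (∀ n, 0 ≤ β n ∧ β n < criticalBeta 3) ∧ Tendsto β atTop (𝓝 (criticalBeta 3)) ∧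
      (∀ n, IsProbabilityMeasure (ν n)) ∧ (∀ n, (ν n) {s | ∃ i, s i < 0} = 0) ∧
      (∀ n (x : Site 3), twoPointFree 3 (β n) x =
        ∫ s, Real.exp (-∑ i, s i * ((x i : ℝ)) ^ 2) ∂(ν n))) :
    ∃ μ : Measure (Fin 3 → ℝ), IsProbabilityMeasure μ ∧ μ {t | ∃ i, t i < 0 ∨ 1 < t i} = 0 ∧
      ∀ x : Site 3, criticalTwoPoint 3 x = ∫ t, ∏ i, (t i) ^ ((x i).natAbs ^ 2) ∂μ := by
  obtain ⟨β, ν, hβ, hβlim, hP, hoct, hrep⟩ := h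
  have hlim : ∀ x : Site 3,
      Tendsto (fun n => twoPointFree 3 (β n) x) atTop (𝓝 (criticalTwoPoint 3 x)) :=
    Theorems.CriticalTwoPointGSMTransfer.twoPointFree_seq_tendsto_criticalTwoPoint
      (fun n => (hβ n).2) hβlim
  exact Theorems.cubeRep_of_approximants (fun n => twoPointFree 3 (β n)) (criticalTwoPoint 3) ν hP
    hoct hrep hlim

/-! ## The composition -/

/-- **Skeleton theorem.** The crux `CriticalTwoPointGSM` from the stubs: `closedConeGSM` (physical)
is a cube representation of `criticalTwoPoint 3`, `faceAbsorption` removes the face mass, and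
`Theorems.criticalTwoPointGSM_of_cubeRepNoFace` (p98640) concludes. -/
theorem CriticalTwoPointGSM_of : CriticalTwoPointGSM :=
  Theorems.criticalTwoPointGSM_of_cubeRepNoFace (faceAbsorption closedConeGSM)

end

end Summit.CriticalPhenomena.Ising3DConformalLimit.Cruxes.CriticalTwoPointGSM.Lines.Sketch
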